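import Literature.Barriers.RiemannHypothesis.TuranPartialSums
import Literature.NumberTheory.LFunctions.ZetaClassicalRegionBounds
import Literature.NumberTheory.BeurlingPrimes.PowerProductCount
import HarnessLib

/-!
# Sections of `ζ` beyond `σ = 1`: Turán's zero-free half-plane `σ ≥ 1 + 2 log log N/log N` (proved)

Barrier catalogue `Literature/Barriers/RiemannHypothesis/`, companion of `TuranPartialSums.lean`
(proofs only; no definitions, no named facts). It DISCHARGES the named fact
`Literature.Barriers.RiemannHypothesis.Turan1948_thmIV_zeroFree` (Turán 1948, Theorem IV as quoted
in Montgomery 1983, §1; Gonek–Ledoan 2010, Theorem 1: "For `X` sufficiently large `F_X(s)` has no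
zeros in the half-plane `σ ≥ 1 + 2 log log X/log X`"; Roy–Vatwani 2019, §1: "In the same paper, he
was also able to prove that `ζ_N(s)` does not vanish in the half-plane `σ ≥ 1 + 2(log log N)/log N`,
for all large `N`"), with the explicit threshold `N ≥ 16`:

* `norm_riemannZeta_sub_zetaPartialSum_le` — the tail: `‖ζ(s) − ζ_N(s)‖ ≤ N^{1−σ}/(σ − 1)` for
  `σ = Re s > 1`, `N ≥ 1`;
* `zetaPartialSum_ne_zero_of_loglog` — for `N ≥ 16` and `Re s ≥ 1 + 2 log log N/log N`,
  `ζ_N(s) ≠ 0`;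
* `Turan1948_thmIV_zeroFree_holds : Turan1948_thmIV_zeroFree`.

This is the TRUE zero-free statement printed next to Turán's (refuted) hypotheses
`TuranHypothesisLog3`, `TuranHypothesisIII ε`, … in Roy–Vatwani 2019, §1; by Montgomery 1983 and
Montgomery–Vaughan 2001 the exact threshold is `(4/π − 1) log log N/log N`
(`Montgomery1983_theorem`, `MontgomeryVaughan2001_zeroFree`, named facts), of which the constant `2`
here is the elementary upper side.

## The argument (Turán 1948; cf. Montgomery 1983, §1)

For `Re s = σ > 1`, `ζ(s) − ζ_N(s) = Σ_{n > N} n^{−s}` has norm at most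
`Σ_{n > N} n^{−σ} ≤ N^{1−σ}/(σ − 1)` (mean value theorem, the tree's
`Literature.NumberTheory.BeurlingPrimes.tsum_tail_le`), while `‖ζ(s)‖ ≥ (σ − 1)/σ` because
`1/ζ(s) = Σ μ(n) n^{−s}` has norm `≤ ζ(σ) ≤ σ/(σ − 1)` (the tree's
`Literature.NumberTheory.LFunctions.ZetaClassicalRegion.norm_riemannZeta_ge_of_one_lt_re`).
If `ζ_N(s) = 0` with `1 < σ < 2` then `(σ − 1)² ≤ σ N^{1−σ} < 2 N^{1−σ}`. For
`σ − 1 ≥ δ_N := 2 log log N/log N` one has `N^{1−σ} ≤ N^{−δ_N} = (log N)^{−2}` and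
`(σ − 1)² ≥ δ_N² = 4 (log log N)²/(log N)² ≥ 4/(log N)²` once `log log N ≥ 1`, i.e. for `N ≥ 16`
(`one_le_loglog_of_sixteen_le`): contradiction. For `σ ≥ 2` there are no zeros at all
(`zetaPartialSum_ne_zero_of_two_le_re`).

## References

* [GonekLedoan2010] S. M. Gonek, A. H. Ledoan, *Zeros of partial sums of the Riemann zeta-function*,
  Int. Math. Res. Not. IMRN 2010, no. 10, 1775–1791, Theorem 1 (arXiv:0807.0019, p. 2; read).
* [RoyVatwani2019] A. Roy, A. Vatwani, *Zeros of partial sums of L-functions*, Adv. Math. 346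
  (2019), §1 (arXiv:1807.11093, p. 3; read).
* [Montgomery1983] H. L. Montgomery, *Zeros of approximations to the zeta function*, in: Studies in
  Pure Mathematics (to the memory of P. Turán), Birkhäuser 1983, 497–506, §1.
* [Turan1948] P. Turán, *On some approximative Dirichlet-polynomials in the theory of the
  zeta-function of Riemann*, Danske Vid. Selsk. Mat.-Fys. Medd. 24 (1948), no. 17, Theorem IV (as
  quoted in [Montgomery1983, §1]; not held).
-/

noncomputable section

open Complex

namespace Literature.Barriers.RiemannHypothesis

/-! ## The tail of the zeta series -/

/-- **The tail of the Dirichlet series of `ζ` beyond a section.** For `Re s = σ > 1` and `N ≥ 1`,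
`‖ζ(s) − ζ_N(s)‖ ≤ N^{1−σ}/(σ − 1)`: indeed `ζ(s) − ζ_N(s) = Σ_{n > N} n^{−s}`,
`‖n^{−s}‖ = n^{−σ}`, and `Σ_{n > N} n^{−σ} ≤ N^{1−σ}/(σ − 1)` (mean value theorem). [folklore] -/
theorem norm_riemannZeta_sub_zetaPartialSum_le {N : ℕ} (hN : 1 ≤ N) {s : ℂ} (hs : 1 < s.re) :
    ‖riemannZeta s - zetaPartialSum N s‖ ≤ (N : ℝ) ^ (1 - s.re) / (s.re - 1) := by
  have hsum : LSeriesSummable 1 s := LSeriesSummable_one_iff.mpr hs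
  rw [← LSeries_one_eq_riemannZeta hs, LSeries, zetaPartialSum_eq_sum_term,
    ← hsum.sum_add_tsum_nat_add (N + 1), add_sub_cancel_left]
  have hnorm : ∀ i : ℕ,
      ‖LSeries.term 1 s (i + (N + 1))‖ = ((i + (N + 1) : ℕ) : ℝ) ^ (-s.re) := by
    intro i
    rw [LSeries.norm_term_eq, if_neg (by omega : i + (N + 1) ≠ 0), Pi.one_apply, norm_one,
      Real.rpow_neg (Nat.cast_nonneg _), one_div]
  have hg : Summable fun i : ℕ ↦ ((i + (N + 1) : ℕ) : ℝ) ^ (-s.re) :=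
    (summable_nat_add_iff (N + 1)).mpr
      (Literature.NumberTheory.BeurlingPrimes.summable_rpow_neg hs)
  have hg' : Summable fun i : ℕ ↦ ‖LSeries.term 1 s (i + (N + 1))‖ := by
    simp_rw [hnorm]; exact hg
  calc ‖∑' i : ℕ, LSeries.term 1 s (i + (N + 1))‖
      ≤ ∑' i : ℕ, ‖LSeries.term 1 s (i + (N + 1))‖ := norm_tsum_le_tsum_norm hg'
    _ = ∑' i : ℕ, ((i + (N + 1) : ℕ) : ℝ) ^ (-s.re) := by simp_rw [hnorm]
    _ ≤ (N : ℝ) ^ (1 - s.re) / (s.re - 1) :=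
        Literature.NumberTheory.BeurlingPrimes.tsum_tail_le hs hN

/-! ## Turán's zero-free half-plane -/

/-- `N^{−2 log log N/log N} = (log N)^{−2}` for `N ≥ 2` (so that `log N > 0`). [folklore] -/
theorem rpow_neg_two_mul_loglog_div_log {N : ℕ} (hN : 2 ≤ N) :
    (N : ℝ) ^ (-(2 * Real.log (Real.log N) / Real.log N)) = ((Real.log N) ^ 2)⁻¹ := by
  have hNpos : (0 : ℝ) < N := by exact_mod_cast (by omega : 0 < N)
  have hlogN : 0 < Real.log N := Real.log_pos (by exact_mod_cast (by omega : 1 < N))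
  rw [Real.rpow_def_of_pos hNpos]
  have h1 : Real.log N * -(2 * Real.log (Real.log N) / Real.log N)
      = -(2 * Real.log (Real.log N)) := by
    field_simp
  rw [h1, Real.exp_neg]
  congr 1
  have h2 : (2 : ℝ) * Real.log (Real.log N) = Real.log (Real.log N ^ 2) := by
    rw [Real.log_pow]; norm_num
  rw [h2, Real.exp_log (pow_pos hlogN 2)]

/-- **Turán 1948, Theorem IV, with the explicit threshold `N ≥ 16`:** for `N ≥ 16` the section
`ζ_N(s) = Σ_{n ≤ N} n^{−s}` has no zero in the closed half-plane `Re s ≥ 1 + 2 log log N/log N`.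
(Proof in the module docstring: `(σ−1)/σ ≤ ‖ζ(s)‖ = ‖ζ(s) − ζ_N(s)‖ ≤ N^{1−σ}/(σ−1)` is
impossible for `2 log log N/log N ≤ σ − 1 < 1` once `log log N ≥ 1`; `σ ≥ 2` is
`zetaPartialSum_ne_zero_of_two_le_re`.)
[cite: GonekLedoan2010, Theorem 1] [cite: Montgomery1983, §1] -/
theorem zetaPartialSum_ne_zero_of_loglog {N : ℕ} (hN : 16 ≤ N) {s : ℂ}
    (hs : 1 + 2 * Real.log (Real.log N) / Real.log N ≤ s.re) : zetaPartialSum N s ≠ 0 := by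
  obtain ⟨hlogN, hloglog⟩ := one_le_loglog_of_sixteen_le hN
  have hN1 : 1 ≤ N := by omega
  rcases le_or_gt 2 s.re with h2 | h2
  · exact zetaPartialSum_ne_zero_of_two_le_re hN1 h2
  intro hzero
  -- abbreviations: `L = log N > 0`, `M = log log N ≥ 1`, `u = σ − 1 ∈ [2M/L, 1)`
  set L : ℝ := Real.log N with hL
  set M : ℝ := Real.log (Real.log N) with hM
  have hδpos : 0 < 2 * M / L := div_pos (by linarith) hlogN
  have hσ1 : 1 < s.re := by linarith
  -- `u L ≥ 2 M ≥ 2`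
  have huL : 2 ≤ (s.re - 1) * L := by
    have h := (div_le_iff₀ hlogN).mp (show 2 * M / L ≤ s.re - 1 by linarith)
    linarith
  -- the two bounds on `‖ζ(s)‖`
  have hlow : (s.re - 1) / s.re ≤ ‖riemannZeta s‖ :=
    Literature.NumberTheory.LFunctions.ZetaClassicalRegion.norm_riemannZeta_ge_of_one_lt_re hσ1
  have hup : ‖riemannZeta s‖ ≤ (N : ℝ) ^ (1 - s.re) / (s.re - 1) := by
    have h := norm_riemannZeta_sub_zetaPartialSum_le hN1 hσ1
    rwa [hzero, sub_zero] at h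
  -- `N^{1−σ} ≤ N^{−2M/L} = L^{−2}`
  have hN1' : (1 : ℝ) ≤ N := by exact_mod_cast hN1
  have hE : (N : ℝ) ^ (1 - s.re) ≤ (L ^ 2)⁻¹ := by
    calc (N : ℝ) ^ (1 - s.re) ≤ (N : ℝ) ^ (-(2 * M / L)) :=
          Real.rpow_le_rpow_of_exponent_le hN1' (by linarith)
      _ = (L ^ 2)⁻¹ := rpow_neg_two_mul_loglog_div_log (by omega)
  -- combine: `u² ≤ σ N^{1−σ} ≤ 2 L^{−2}`, against `(uL)² ≥ 4`
  have hσpos : 0 < s.re := by linarith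
  have hu : 0 < s.re - 1 := by linarith
  have h1 : (s.re - 1) * (s.re - 1) ≤ (N : ℝ) ^ (1 - s.re) * s.re := by
    have h := hlow.trans hup
    rwa [div_le_div_iff₀ hσpos hu] at h
  have hEnn : 0 ≤ (N : ℝ) ^ (1 - s.re) := Real.rpow_nonneg (Nat.cast_nonneg N) _
  have h2 : (s.re - 1) * (s.re - 1) ≤ 2 * (L ^ 2)⁻¹ := by
    calc (s.re - 1) * (s.re - 1) ≤ (N : ℝ) ^ (1 - s.re) * s.re := h1
      _ ≤ (N : ℝ) ^ (1 - s.re) * 2 := mul_le_mul_of_nonneg_left h2.le hEnn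
      _ ≤ (L ^ 2)⁻¹ * 2 := mul_le_mul_of_nonneg_right hE (by norm_num)
      _ = 2 * (L ^ 2)⁻¹ := mul_comm _ _
  have hL2 : 0 < L ^ 2 := pow_pos hlogN 2
  have h3 : (s.re - 1) * (s.re - 1) * L ^ 2 ≤ 2 := by
    calc (s.re - 1) * (s.re - 1) * L ^ 2 ≤ 2 * (L ^ 2)⁻¹ * L ^ 2 :=
          mul_le_mul_of_nonneg_right h2 hL2.le
      _ = 2 := by rw [mul_assoc, inv_mul_cancel₀ hL2.ne', mul_one]
  have h4 : 4 ≤ (s.re - 1) * (s.re - 1) * L ^ 2 := by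
    have h0 : (0 : ℝ) ≤ 2 := by norm_num
    calc (4 : ℝ) = 2 * 2 := by norm_num
      _ ≤ ((s.re - 1) * L) * ((s.re - 1) * L) := mul_le_mul huL huL h0 (h0.trans huL)
      _ = (s.re - 1) * (s.re - 1) * L ^ 2 := by ring
  linarith

/-- **Turán 1948, Theorem IV — the named fact `Turan1948_thmIV_zeroFree`, discharged:** there is
`N₀` (here `N₀ = 16`) such that for all `N ≥ N₀` the section `ζ_N` has no zero in
`Re s ≥ 1 + 2 log log N/log N` ("For `X` sufficiently large `F_X(s)` has no zeros in the half-plane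
`σ ≥ 1 + 2 log log X/log X`", Gonek–Ledoan 2010, Theorem 1, crediting Turán 1948; Roy–Vatwani 2019,
§1). [cite: GonekLedoan2010, Theorem 1] [cite: RoyVatwani2019, §1 (arXiv p. 3)]
[cite: Turan1948, Theorem IV as quoted in Montgomery1983 §1] -/
theorem Turan1948_thmIV_zeroFree_holds : Turan1948_thmIV_zeroFree :=
  ⟨16, fun _N hN _s hs ↦ zetaPartialSum_ne_zero_of_loglog hN hs⟩

/-- Consequently the rate hypothesis `TuranHypothesisRate (2 log log N/log N)` HOLDS unconditionally
(cf. `TuranHypothesisRate_two_loglog`, which took `Turan1948_thmIV_zeroFree` as a hypothesis): every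
zero of `ζ_N`, `N ≥ 16`, has `Re s < 1 + 2 log log N/log N`. Together with Montgomery's theorem
(named fact `Montgomery1983_theorem`: rates `c log log N/log N`, `c < 4/π − 1`, FAIL) this brackets
the threshold of the family `TuranHypothesisRate`. [cite: Montgomery1983, §1] -/
theorem TuranHypothesisRate_two_loglog_holds :
    TuranHypothesisRate (fun N ↦ 2 * Real.log (Real.log N) / Real.log N) :=
  TuranHypothesisRate_two_loglog Turan1948_thmIV_zeroFree_holds

end Literature.Barriers.RiemannHypothesis
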